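import Summits.CriticalPhenomena.PercolationContinuityZ3.Theorems.PercNearOneGluingNoHeavyQuantTwoBlobTopFlippedLightSharpFloor
import HarnessLib

/-!
# QUANT lane R8, T-DEC, binder (II): THE EXACT FLOOR THRESHOLD OF THE STANDALONE TOP-FLIPPED LIGHT PIECES — part 4: below the threshold
# (kernel witnesses at `x = 1/5`; sharpness of the floor `x³ + x² + 3x ≥ 1` in the real variables)

builds on p205010 (kernel theorem, internal audit signed; external expert review pending)

Support file (`--supports stmt-CriticalPhenomena-4575`), QUANT lane seat prim-quant-arm-2 (gen 32), rung R8 of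
`run/shared/lean/prim/quant/LADDER.md`.  Companion of `…TwoBlobTopFlippedLightSharpFloor` (the positive side: DEC at every aspect ratio for
`1 ≤ x³ + x² + 3x`).  Here:
* `LawDec.not_decAtT_topFlipped_lightHeavy_fifth`, `LawDec.not_decAtT_topFlipped_lightLight_fifth` — at floor `x = 1/5 < x*` the top-flipped
  light pieces of aspect 10 (light–heavy) and 7 (light–light, census-2 g59's raw-cell witness for `LightSliceWide`) are NOT `DECAtT` at the sum of
  the ARCH credits, all other hypotheses of arm-2 g31's piece lemmas holding: neither the aspect bound nor the floor can be dropped, and the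
  `LightSliceWide` residue of (II) is genuinely pooled below the threshold;
* `LawDec.topFlipped_capacity_LH_fails_below_threshold` — for EVERY floor with `x³ + x² + 3x < 1` the light–heavy capacity inequality fails at the
  extreme configuration (heavy cell at the floor gate and incompatible, aspect `x/2`), where the slack is `x³(x³ + x² + 3x − 1)/(4(x² + (1−x)x/2))`:
  the floor of part 3 is SHARP.
Theorems only, standard axioms, no sorries, no definitions.

[this work]; the single-low criterion `…QuantSingleLowCapacity` (typer g23), the residue `LightSliceWide` (census-2 g59) — this lane.  Nothing
here is cited as a published result.  The gluing rows served [cite: KozmaNitzan2024, Conjecture 3 (p. 15)]; product measure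
[cite: Grimmett1999, §1.3 p. 10].
-/

noncomputable section

namespace Summit.CriticalPhenomena.PercolationContinuityZ3.Theorems

namespace Quant

open Finset

/-- the two-blob law `(1−u)(1−v)δ₀ + u(1−v)δ_a + (1−u)vδ_b + uvδ_{a+b}` evaluated at `h` (as in `…QuantBlobDecTwoLawParts`) -/
local notation3 "LAW2[" a ", " u ", " b ", " v ", " h "]" =>
  (1 - (u : ℝ)) * (1 - (v : ℝ)) * (if (h : ℕ) = 0 then (1 : ℝ) else 0)
    + (u : ℝ) * (1 - (v : ℝ)) * (if (h : ℕ) = (a : ℕ) then (1 : ℝ) else 0)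
    + (1 - (u : ℝ)) * (v : ℝ) * (if (h : ℕ) = (b : ℕ) then (1 : ℝ) else 0)
    + (u : ℝ) * (v : ℝ) * (if (h : ℕ) = (a : ℕ) + (b : ℕ) then (1 : ℝ) else 0)

namespace LawDec

/-! ### Below the threshold the hypotheses cannot be dropped: kernel witnesses at `x = 1/5` -/

/-- **NEGATIVE (L⊗H).**  At floor `x = 1/5` (`x³ + x² + 3x = 0.648 < 1`) the top-flipped light–heavy piece with the light cell TEN times
as long as the heavy one — `A = 10` at credit rate `2/25` (gate `13/125`), `B = 1` heavy AT the floor gate `1/5`, target the sum of the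
ARCH credits `c = 10·(2/25) + 1·(1/5) = 1`, layer `j = 10` (cross atoms mids, top `11` a giant) — is NOT `DECAtT`: every hypothesis of
`twoBlob_topFlipped_lightHeavy_decAtT` holds except the aspect bound `A ≤ 4B`, and every hypothesis of `…_of_sharpFloor` except the floor.
This is the extreme configuration of the sharpness analysis (short cell incompatible: `c/B = 1`; its gate at the heavy boundary `x`;
aspect `B/A = x/2`).  By the single-low criterion the capacity inequality reads `112/625 ≤ 13/75`, which is false. [this work] -/
theorem not_decAtT_topFlipped_lightHeavy_fifth :
    ¬ DECAtT (1 / 5 : ℝ) 1 10 11 (fun h => LAW2[10, (13 / 125 : ℝ), 1, (1 / 5 : ℝ), h]) := by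
  classical
  intro hdec
  have hν0 : ∀ k : ℕ, 0 ≤ LAW2[10, (13 / 125 : ℝ), 1, (1 / 5 : ℝ), k] := fun k =>
    BlobDec2.law_nonneg 10 1 (13 / 125 : ℝ) (1 / 5 : ℝ) (by norm_num) (by norm_num) (by norm_num) (by norm_num) k
  have hνM : ∀ k : ℕ, 11 < k → LAW2[10, (13 / 125 : ℝ), 1, (1 / 5 : ℝ), k] = 0 := fun k hk =>
    BlobDec2.law_eq_zero_of_lt 10 1 (13 / 125 : ℝ) (1 / 5 : ℝ) k (by omega)
  have hν1 : ∑ h ∈ Finset.range (11 + 1), LAW2[10, (13 / 125 : ℝ), 1, (1 / 5 : ℝ), h] = 1 :=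
    BlobDec2.law_mass 10 1 (13 / 125 : ℝ) (1 / 5 : ℝ)
  have hsingle : ∀ k : ℕ, k ≤ 10 → 2 * (k : ℝ) < 1 → k ≠ 0 → LAW2[10, (13 / 125 : ℝ), 1, (1 / 5 : ℝ), k] = 0 := by
    intro k _ hk hk0
    have hk1 : (k : ℝ) < 1 := by linarith
    have : k < 1 := by exact_mod_cast hk1
    omega
  have hcap := (decAtT_singleLow_iff (1 / 5 : ℝ) 1 10 11 0 _ (by norm_num) (by norm_num) hν0 hνM hν1 (Nat.zero_le _)
    (by norm_num) hsingle).1 hdec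
  have lhs : LAW2[10, (13 / 125 : ℝ), 1, (1 / 5 : ℝ), 0] = (1 - 13 / 125) * (1 - 1 / 5) := by norm_num
  have rhs : ∑ h ∈ Finset.range (11 + 1), capCoef (1 / 5 : ℝ) 1 10 0 h * LAW2[10, (13 / 125 : ℝ), 1, (1 / 5 : ℝ), h]
      = capCoef (1 / 5 : ℝ) 1 10 0 10 * ((13 / 125 : ℝ) * (1 - 1 / 5))
        + capCoef (1 / 5 : ℝ) 1 10 0 1 * ((1 - 13 / 125 : ℝ) * (1 / 5)) + (13 / 125 : ℝ) * (1 / 5) := by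
    simp_rw [mul_add, Finset.sum_add_distrib]
    rw [sum_range_mul_const_indicator 11 0 (by norm_num), sum_range_mul_const_indicator 11 10 (by norm_num),
      sum_range_mul_const_indicator 11 1 (by norm_num), sum_range_mul_const_indicator 11 (10 + 1) (by norm_num),
      capCoef_zero_self (1 / 5 : ℝ) 1 10 (by norm_num), capCoef_giant (1 / 5 : ℝ) 1 10 0 (10 + 1) (by norm_num)]
    ring
  have eA : capCoef (1 / 5 : ℝ) 1 10 0 10 = 11 / 6 := by
    rw [capCoef_zero_mid (1 / 5 : ℝ) 1 10 10 (by norm_num) (by norm_num) le_rfl (by norm_num) (by norm_num) (by norm_num)]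
    rw [max_eq_right (by norm_num)]
    norm_num
  have eB : capCoef (1 / 5 : ℝ) 1 10 0 1 = 0 :=
    capCoef_zero_mid_incompat (1 / 5 : ℝ) 1 10 1 (by norm_num) (by norm_num)
  rw [lhs, rhs, eA, eB] at hcap
  norm_num at hcap

/-- **NEGATIVE (L⊗L)** — census-2 g59's raw-cell witness for the pooled class `LightSliceWide`, now in the kernel.  At floor `x = 1/5` the
top-flipped light–light piece with cells `(0,1)` at credit `1/8` and `(0,7)` at credit `7/8` (both gates `7/50`, credit rate `1/8 < x`),
target `c = 1`, layer `j = 7` (top `8` a giant) — aspect `7 > 4` — is NOT `DECAtT`: every hypothesis of `twoBlob_topFlipped_lightLight_decAtT`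
holds except `B ≤ 4A`, and every hypothesis of `…_of_sharpFloor` except the floor.  Capacity inequality: `1849/10000 ≤ 12460/67500`, false
(margin `3·10⁻⁴`).  So below the threshold the light ⊗ light residue of (II) is genuinely POOLED. [this work] -/
theorem not_decAtT_topFlipped_lightLight_fifth :
    ¬ DECAtT (1 / 5 : ℝ) 1 7 8 (fun h => LAW2[1, (7 / 50 : ℝ), 7, (7 / 50 : ℝ), h]) := by
  classical
  intro hdec
  have hν0 : ∀ k : ℕ, 0 ≤ LAW2[1, (7 / 50 : ℝ), 7, (7 / 50 : ℝ), k] := fun k =>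
    BlobDec2.law_nonneg 1 7 (7 / 50 : ℝ) (7 / 50 : ℝ) (by norm_num) (by norm_num) (by norm_num) (by norm_num) k
  have hνM : ∀ k : ℕ, 8 < k → LAW2[1, (7 / 50 : ℝ), 7, (7 / 50 : ℝ), k] = 0 := fun k hk =>
    BlobDec2.law_eq_zero_of_lt 1 7 (7 / 50 : ℝ) (7 / 50 : ℝ) k (by omega)
  have hν1 : ∑ h ∈ Finset.range (8 + 1), LAW2[1, (7 / 50 : ℝ), 7, (7 / 50 : ℝ), h] = 1 :=
    BlobDec2.law_mass 1 7 (7 / 50 : ℝ) (7 / 50 : ℝ)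
  have hsingle : ∀ k : ℕ, k ≤ 7 → 2 * (k : ℝ) < 1 → k ≠ 0 → LAW2[1, (7 / 50 : ℝ), 7, (7 / 50 : ℝ), k] = 0 := by
    intro k _ hk hk0
    have hk1 : (k : ℝ) < 1 := by linarith
    have : k < 1 := by exact_mod_cast hk1
    omega
  have hcap := (decAtT_singleLow_iff (1 / 5 : ℝ) 1 7 8 0 _ (by norm_num) (by norm_num) hν0 hνM hν1 (Nat.zero_le _)
    (by norm_num) hsingle).1 hdec
  have lhs : LAW2[1, (7 / 50 : ℝ), 7, (7 / 50 : ℝ), 0] = (1 - 7 / 50) * (1 - 7 / 50) := by norm_num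
  have rhs : ∑ h ∈ Finset.range (8 + 1), capCoef (1 / 5 : ℝ) 1 7 0 h * LAW2[1, (7 / 50 : ℝ), 7, (7 / 50 : ℝ), h]
      = capCoef (1 / 5 : ℝ) 1 7 0 1 * ((7 / 50 : ℝ) * (1 - 7 / 50))
        + capCoef (1 / 5 : ℝ) 1 7 0 7 * ((1 - 7 / 50 : ℝ) * (7 / 50)) + (7 / 50 : ℝ) * (7 / 50) := by
    simp_rw [mul_add, Finset.sum_add_distrib]
    rw [sum_range_mul_const_indicator 8 0 (by norm_num), sum_range_mul_const_indicator 8 1 (by norm_num),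
      sum_range_mul_const_indicator 8 7 (by norm_num), sum_range_mul_const_indicator 8 (1 + 7) (by norm_num),
      capCoef_zero_self (1 / 5 : ℝ) 1 7 (by norm_num), capCoef_giant (1 / 5 : ℝ) 1 7 0 (1 + 7) (by norm_num)]
    ring
  have eA : capCoef (1 / 5 : ℝ) 1 7 0 1 = 0 :=
    capCoef_zero_mid_incompat (1 / 5 : ℝ) 1 7 1 (by norm_num) (by norm_num)
  have eB : capCoef (1 / 5 : ℝ) 1 7 0 7 = 37 / 27 := by
    rw [capCoef_zero_mid (1 / 5 : ℝ) 1 7 7 (by norm_num) (by norm_num) le_rfl (by norm_num) (by norm_num) (by norm_num)]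
    rw [max_eq_right (by norm_num)]
    norm_num
  rw [lhs, rhs, eA, eB] at hcap
  norm_num at hcap

/-! ### Sharpness of the floor in the real variables -/

/-- **THE FLOOR `x³ + x² + 3x ≥ 1` IS SHARP** for the light–heavy capacity inequality `topFlipped_capacity_LH_sharp`: for EVERY floor
`0 < x < 1` with `x³ + x² + 3x < 1` (i.e. `4x² < (1 − x)³`) the inequality FAILS at the extreme configuration — the heavy cell at the floor
gate `q = x` and incompatible (`Q′ = 1`), the light cell at credit rate `p = x(1−x)/2`, raised rate `P′ = x/2` (aspect heavy/light `= x/2`);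
there the slack equals `x·((1−x)³(P′ − x/2)² + (x²/4)(x³ + x² + 3x − 1))/(…) < 0`.  All other hypotheses of the capacity theorem hold
(`(P′ − p)(Q′ − q) = pq`, `P′, Q′ ≤ 2`). [this work] -/
theorem topFlipped_capacity_LH_fails_below_threshold (x : ℝ) (hx0 : 0 < x) (hx1 : x < 1)
    (hxS : x ^ 3 + x ^ 2 + 3 * x < 1) :
    ∃ p q P' Q' : ℝ, 0 < p ∧ p < x ∧ x ≤ q ∧ q ≤ 1 ∧ p < P' ∧ (P' - p) * (Q' - q) = p * q ∧ P' ≤ 2 ∧ Q' ≤ 2 ∧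
      ¬ (x / (1 - x) * ((1 - (x ^ 2 + (1 - x) * p)) * (1 - q)) ≤
        (if P' < 1 then x / (1 - x) * ((1 - max P' (x ^ 2 + (1 - x) * P')) / max P' (x ^ 2 + (1 - x) * P')) else 0)
            * ((x ^ 2 + (1 - x) * p) * (1 - q))
          + (if Q' < 1 then x / (1 - x) * ((1 - max Q' (x ^ 2 + (1 - x) * Q')) / max Q' (x ^ 2 + (1 - x) * Q')) else 0)
            * ((1 - (x ^ 2 + (1 - x) * p)) * q)
          + (x ^ 2 + (1 - x) * p) * q) := by
  have h1x : 0 < 1 - x := by linarith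
  refine ⟨x * (1 - x) / 2, x, x / 2, 1, div_pos (mul_pos hx0 h1x) two_pos, by nlinarith, le_rfl, hx1.le, by nlinarith, by ring,
    by linarith, by norm_num, ?_⟩
  have hP1 : x / 2 < 1 := by linarith
  rw [if_pos hP1, if_neg (lt_irrefl _), max_eq_right (by nlinarith : x / 2 ≤ x ^ 2 + (1 - x) * (x / 2))]
  have hG : 0 < x ^ 2 + (1 - x) * (x / 2) := add_pos_of_pos_of_nonneg (pow_pos hx0 2) (mul_nonneg h1x.le (by linarith))
  have hne1 : (1:ℝ) - x ≠ 0 := h1x.ne'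
  have hGne : x ^ 2 + (1 - x) * (x / 2) ≠ 0 := hG.ne'
  intro h
  have key : x / (1 - x) * ((1 - (x ^ 2 + (1 - x) * (x / 2))) / (x ^ 2 + (1 - x) * (x / 2)))
        * ((x ^ 2 + (1 - x) * (x * (1 - x) / 2)) * (1 - x)) + 0 * ((1 - (x ^ 2 + (1 - x) * (x * (1 - x) / 2))) * x)
        + (x ^ 2 + (1 - x) * (x * (1 - x) / 2)) * x - x / (1 - x) * ((1 - (x ^ 2 + (1 - x) * (x * (1 - x) / 2))) * (1 - x))
      = x ^ 3 * (x ^ 3 + x ^ 2 + 3 * x - 1) / (4 * (x ^ 2 + (1 - x) * (x / 2))) := by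
    field_simp
    ring
  have hneg : x ^ 3 * (x ^ 3 + x ^ 2 + 3 * x - 1) / (4 * (x ^ 2 + (1 - x) * (x / 2))) < 0 :=
    div_neg_of_neg_of_pos (mul_neg_of_pos_of_neg (pow_pos hx0 3) (by linarith)) (by linarith)
  linarith


end LawDec

end Quant

end Summit.CriticalPhenomena.PercolationContinuityZ3.Theorems
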